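import Summits.BirchSwinnertonDyer.BirchSwinnertonDyer.Theses.ErratumRoadFive
import Summits.BirchSwinnertonDyer.BirchSwinnertonDyer.Theorems.ErratumRoadFiveNonSurjCornerTamagawaCarriers
import Summits.BirchSwinnertonDyer.BirchSwinnertonDyer.Theorems.ErratumRoadFiveEulerHalfGenusSharpKolyvaginCarrier
import Summits.BirchSwinnertonDyer.Rank1Residual.X11b.Three.KolyvaginLine
import Literature.NumberTheory.EllipticCurves.KolyvaginShaStructure
import Literature.NumberTheory.EllipticCurves.ModularCurveIharaLemma
import Literature.NumberTheory.EllipticCurves.ModularJacobianModPMultiplicityOne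
import Literature.NumberTheory.EllipticCurves.CaiShuTian2014.HeegnerConditionProofs
import Literature.NumberTheory.EllipticCurves.LFunctionPrimeCoeffMultiplicative
import Literature.NumberTheory.EllipticCurves.HeegnerPointReflectionProofs
import Literature.NumberTheory.EllipticCurves.LocalTorsionMultiplicativeProofs
import Literature.NumberTheory.EllipticCurves.PAdicBSDSplitMultiplicativeProofs
import Literature.NumberTheory.EllipticCurves.TamagawaPrimesEquivProofs
import Literature.NumberTheory.EllipticCurves.PAdicHeights
import HarnessLib

/-!
# Line `carrier_absorption` — crux idea `carrier-old-congruence-absorption` (bsd-idea-9, lens complete), rev 1.2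

UNREGISTERED supporting line (W-71/W-79: published with `ledger crux write` only; the lines of record
stay `Cruxes/EulerHalfNotRamNoInertSetAtFive/Lines/birth.lean` v17 for item 19715 and
`Cruxes/EulerHalfPOnlyMultPotMultTwinAtFive/Lines/genus.lean` v1.2′ for item 23444).

REV 1.2 (g21) = rev 1.1 VERBATIM (§0–§5, the four stubs, every statement byte-identical) + §6 (D)-TRANSPORT at the
end of the file (sorry-free, imports genus-p2's `Theorems/ErratumRoadFiveEulerHalfGenusSharpKolyvaginCarrier`): the
POINT-LEVEL clause (D′) «`P_m ∈ p^{min(M,t)}·A_m`» — this line's output currency on the `E′`-side, pushed through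
the twist isomorphism — implies genus-p2's CLASS-LEVEL clause (D) «`p^{M−t}·c_M(P_m) = 0`» of item 23444's S4♯
(`zsmul_kolyvaginClass_eq_zero_of_zsmul_eq`, `pow_sub_zsmul_kolyvaginClass_eq_zero_of_pointDiv`), and S4♭'s
inequality follows from the (D′)-datum (`GenusKolyvaginEprimePointsRDiv`,
`padicValNat_card_sha_add_le_of_genusKolyvaginEprimePointsRDiv`, PROVED over genus-p2's glue).  A Theorems-shaped
copy of §6 (no `def`; `…EprimePointsDiv` with the datum inlined) is offered to the pen as a `--supports 23444` helper.

REV 1.1 pays the mechanism critic's prices on rev 1.0 (idea-crit-14 VERDICT #98, PASS-WITH-PRICE, 0 strikes):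
* P2 CURRENCY — `AbsorptionAt` now concludes the tree's `PDiv d p s` (`P(n) ∈ p^s W(K[n])`, exact:
  `W(K[n])[p] = 0` under `Surj`, Gross 1991 Lemma 4.3) and reads the depth of a layer per prime,
  `s ≤ Zhang2014.kolyvaginIndex W p ℓ` for `ℓ ∣ n` — literally the inner shape of the consumer's `hJmax`.
* P3 GLUE TYPED AND PROVED — `JetchevMaxHLAt W p` is the body of the `hJmax` binder of the tree's S1b
  consumer `…Lines/ramified_twin.lean: res_pOnlyMultCarrierAtFive_of_jetchevMaxHL_of_hlTwinLowerSupplyAt`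
  at ONE curve (its inner consumer applies `hJmax` only at `W`, l.273), `JetchevMaxHLAtFrame` prepends the
  frame binders (`p` the only multiplicative prime, split), and
  `jetchevMaxHLAtFrame_of_carrierOldCongruenceAbsorption : CarrierOldCongruenceAbsorption → JetchevMaxHLAtFrame`
  is kernel-checked (`N₀ := N/p` by `factorization_conductorNorm_eq_one_of_hasMultiplicativeReductionAtPrime`,
  depth by `CornerLocal.padicValNat_tamagawaNumberAt_le`).
* P1 SERVICE SCOPE — the classical statements serve item 19715's frame (Heegner hypothesis for `N_W`).
  For item 23444's GENUS frame (a prime `q ∣ d_K` with `q ∥ N_{E′}`, Heegner points of the FOURTH curve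
  `E′ = W ⊗ χ_{d₁}`, genus character `χ ↔ d₁`) the file adds the SIGN FRAME `FrameAtSign E N₀ p s d₁`
  (`a_p(E)·(d₁/p) = +1`, i.e. the twist `E ⊗ χ_{d₁}` is SPLIT at `p`), the `χ`-twisted derived point
  `chiTwistedDerivedPoint d χ = Σ_{τ∈S} χ(τ)·τ(D_m y)` on the tree's `KolyvaginHeegnerData` of `E`
  (which allows ramified primes `q ∥ N`: only `4N ∣ β² − d_K` is asked), the conclusion `AbsorptionAtChi`,
  the stub S3χ and the composition `carrierOldCongruenceAbsorptionChi_of`; the classical case is the PROVED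
  specialisation `d₁ = 1, θ = 1, χ = 1` (`kummerDescentAlongOldProjection_of_chi`).
* P4 DOCSTRINGS — S1: `U_q ↦ 0 = a_q` at additive `q` via `N(ρ̄) = N₀` (`p ≥ 5`), `T_p ↦ a_p(1+p)` =
  Fontaine–Laffaille ∕ ordinary trace, `T_p ∈ 𝕋′_{𝔪₀}`; S2: the `U_q`–degeneracy commutation for `q ∣ N₀`.
* P5 (numerics at `(N₀,p,s) = (11,5,1)`) is the LEAD ∕ kit seat's (this seat has kit 0).

MECHANISM (E/ℚ globally minimal, `p ≥ 5`, `p ∥ N = N₀p`, `ρ̄ = E[p]` onto, `p^s ∣ ord_pΔ_min(E)`;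
classical frame: `E = W`, `p` its only multiplicative prime, split, `s ≤ t = ord_p c_p`;
sign frame: `a_p(E)(d₁/p) = 1`):
* S1 `OldCongruenceDepth` — the `p`-OLD CONGRUENCE OF DEPTH `s`: a ring map `π_s : 𝕋(N₀) → ℤ/p^s`
  with `π_s(T_r) = a_r(E)` (`r ≠ p`) and `π_s(T_p) = a_p(E)(1+p)` (`E[p^s]` finite flat at `p` ⟺
  `p^s ∣ ord_pΔ`; `R_Σ ≅ 𝕋_Σ`, Diamond 1996 ∕ CSS 1997 Thm 6.1; unit root `u = a_p(E) = ±1`).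
* S2 `OldProjectionBijective` — with `I = (p^s, T_r − a_r(E)) ⊂ 𝕋(N)`, `I_s = ker π_s ⊂ 𝕋(N₀)`, the
  `u`-stabilised old projection `ψ^u = α_* − uβ_*` (`u = a_p(E)`) on `H₁(X₀(N), ℤ)` maps `IΛ_N` into
  `I_sΛ_{N₀}` (`α_*U_p = T_pα_* − β_*`, `β_*U_p = pα_*`, so `ψ^u(U_p − u) = (T_p − u(1+p))α_*`, killed by
  `π_s(T_p) = u(1+p)`) and induces a BIJECTION `Λ_N/IΛ_N ⥲ Λ_{N₀}/I_sΛ_{N₀}` of groups of order `p^{2s}`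
  (onto: Ihara at the non-Eisenstein `𝔪₀`; orders: multiplicity one at both levels).  Elementwise.
* S3 ∕ S3χ `KummerDescentAlongOldProjection(Chi)` — GALOIS SIDE (named fact modulo vocabulary D1/D2):
  `ψ̄_s` is an isomorphism of `G_ℚ`-modules `J₀(N)[p^s]/I ⥲ J₀(N₀)[p^s]/I_s`; on CM divisors
  `α(x_m) = x′_m`, `β(x_m) = σ_𝔭^{∓1}x′_m`, so `ψ(P̃^χ_m) = (1 − u·σ_𝔭^{∓1})P̃′^χ_m`; the class of
  `P̃′^χ_m` with coefficients in `J₀(N₀)[p^s]/I_s` is `χ`-isotypic for `Gal(K[m]/K)` (Gross 1991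
  Prop. 3.6 run with these coefficients: `T_ℓ ∈ I_s`, `p^s ∣ ℓ+1`), so `1 − uσ_𝔭^{∓1}` acts by
  `1 − a_p(E)χ(σ_𝔭) = 1 − a_p(E)(d₁/p) = 0`; injectivity of `ψ̄_{s,*}` on `H¹` and of the Kummer map
  give `P^χ_m ∈ p^s E(K[m])`.
* Compositions (kernel-checked): `carrierOldCongruenceAbsorption_of : S1 → S2 → S3 → C`,
  `carrierOldCongruenceAbsorptionChi_of : S1 → S2 → S3χ → Cχ`, `carrierOldCongruenceAbsorption_of_chi :
  S1 → S2 → S3χ → C`, and `jetchevMaxHLAtFrame_of_carrierOldCongruenceAbsorption : C → JetchevMaxHLAtFrame`.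
* §6 (rev 1.2): (D′) ⟹ (D) for the generic Kolyvagin class and S4♭'s inequality from the (D′)-datum (PROVED).

Nothing here is proved except compositions, frame bridges, the `hJmax`-glue and §6; no summit statement, no
crux and no registered stub is closed by this file.  Sorries: exactly the four `stub_*`.
-/

namespace Summit.BirchSwinnertonDyer.BirchSwinnertonDyer.Cruxes.EulerHalfNotRamNoInertSetAtFive.CarrierAbsorption

set_option linter.dupNamespace false
set_option linter.unusedVariables false
set_option autoImplicit false

open scoped MatrixGroups ModularForm NumberField
open CongruenceSubgroup IsDedekindDomain
open WeierstrassCurve Literature.NumberTheory.EllipticCurves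
open Literature.NumberTheory.EllipticCurves.ModularForms
open Literature.NumberTheory.EllipticCurves.Rank1Residual (Surj)
open Summit.BirchSwinnertonDyer.Rank1Residual.X11b.Three.Koly (PDiv)
open Summit.BirchSwinnertonDyer.BirchSwinnertonDyer.Theorems

/-! ## §0 Vocabulary (definitions over built tree objects only) -/

/-- The LOWERING FRAME at one depth `s` (common to both services): `p ≥ 5`, conductor `N = N₀·p` with
`p ∤ N₀` (so `p ∥ N`: multiplicative at `p`), surjective mod-`p` representation, and
`p^s ∣ ord_pΔ_min(E)` (⟺ `E[p^s]` is finite flat over `ℤ_p`: Tate curve).  Other multiplicative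
primes `q ∥ N₀` ARE allowed (genus frame: the fourth curve `E′` is multiplicative at the ramified `q`).
[cite: Jetchev2008, Thm 1.4 and Hypothesis (∗)] [cite: Diamond1996Annals, Thm 1.1] -/
structure LoweringFrame (E : WeierstrassCurve ℚ) [E.IsElliptic] [E.IsGloballyMinimal] (N₀ p s : ℕ)
    [Fact p.Prime] : Prop where
  five_le : 5 ≤ p
  not_dvd : ¬ p ∣ N₀
  cond : E.conductorNorm ℤ = N₀ * p
  surj : E.HasSurjectiveModNGaloisRep p
  mult : E.HasMultiplicativeReductionAtPrime p
  depth : p ^ s ∣ padicValInt p E.minimalDiscriminantInt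

/-- The CLASSICAL FRAME of the card at one depth `s` (item 19715's service): `p ≥ 5` is the only
multiplicative prime of the globally minimal `W/ℚ`, split, with surjective mod-`p` representation,
conductor `N = N₀·p` with `p ∤ N₀`, and `s ≤ t := ord_p ∏_ℓ c_ℓ(W)` (`= ord_p c_p = ord_p(ord_p Δ_min)` in
this frame, the additive `c_ℓ ≤ 4 < p`; bridge `FrameAt.toLoweringFrame`).
[cite: Jetchev2008, Thm 1.4 and Hypothesis (∗)] [cite: SilvermanATAEC1994, Cor. IV.9.2 (d)] -/
structure FrameAt (W : WeierstrassCurve ℚ) [W.IsElliptic] [W.IsGloballyMinimal] (N₀ p s : ℕ)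
    [Fact p.Prime] : Prop where
  five_le : 5 ≤ p
  not_dvd : ¬ p ∣ N₀
  cond : W.conductorNorm ℤ = N₀ * p
  surj : W.HasSurjectiveModNGaloisRep p
  split : W.HasSplitMultiplicativeReductionAtPrime p
  only : ∀ (ℓ : ℕ) [Fact ℓ.Prime], W.HasMultiplicativeReductionAtPrime ℓ → ℓ = p
  depth : s ≤ padicValNat p W.tamagawaProduct

/-- The SIGN FRAME (item 23444's service, on the fourth curve `E = E′`): the lowering frame plus the
GENUS SIGN CONDITION `a_p(E)·(d₁/p) = +1` for a discriminant `d₁` (so `p ∤ d₁`, and the quadratic twist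
`E ⊗ χ_{d₁}` — the summit curve `W` of 23444 — is SPLIT multiplicative at `p`: `a_p(E ⊗ χ_{d₁}) =
χ_{d₁}(p)a_p(E)`).  `a_p(E) = E.LFunction p = ±1` (Mathlib's local factor `1 ∓ X`).
[cite: SilvermanAEC2009, §C.16 and Ex. 8.19(a)] [cite: GrossZagier1986, §IV (genus characters)] -/
structure FrameAtSign (E : WeierstrassCurve ℚ) [E.IsElliptic] [E.IsGloballyMinimal] (N₀ p s : ℕ)
    (d₁ : ℤ) [Fact p.Prime] : Prop extends LoweringFrame E N₀ p s where
  sign : E.LFunction p * legendreSym p d₁ = 1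

/-- `π : 𝕋(N₀) = HeckeRing0 N₀ 2 →+* ℤ/p^s` MATCHES `E` (an old congruence of depth `s`):
`π(T_r) = a_r(E)` for every prime `r ≠ p` and `π(T_p) = a_p(E)·(1 + p)` (`T_p` the level-`N₀` Hecke
operator, `p ∤ N₀`).  Notes for the prover (critic V98 P4): (a) at an ADDITIVE `q ∣ N₀` the tree's
`HeckeRing0.T N₀ 2 q` is `U_q` and the demand is `π(U_q) = a_q(E) = 0` — automatic for `p ≥ 5` since
`N(ρ̄) = N₀` at such `q` (`ρ̄^{I_q} = 0`, Swan conductors agree), so `S₂(Γ₀(N₀))_{𝔪₀}` is `q`-new and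
`U_q² = 0 ⇒ U_q = 0` there (`q² ∣ N₀`); at a MULTIPLICATIVE `q ∥ N₀` (sign frame only) the demand
`π(U_q) = a_q(E) = ±1` is automatic when `ρ̄` is ramified at `q` (`U_q ∈ 𝕋′_{𝔪₀}`, Wiles 1995 §2.1) and
is the `q`-new eigenvalue choice otherwise — PRICE (q) of S1; (b) `π(T_p) = a_p(E)(1+p)` is the trace
`u + p·u⁻¹` of Frobenius on the finite flat (= ordinary, unit root `u = a_p(E) = ±1`, the unramified
quotient character; `−(1+p)` for non-split) lift `E[p^s]`, i.e. the Fontaine–Laffaille trace, and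
`T_p ∈ 𝕋′_{𝔪₀} = 𝕋_Σ` (`p ∤ N₀`; `𝔪₀` is `D_p`-distinguished as `u ≢ p·u⁻¹`).  `a_r(E) = E.LFunction r`.
[cite: Diamond1996Annals, Thm 1.1 / CSS1997 Thm 6.1] [cite: DarmonDiamondTaylor1995, Thm 3.42, §4.3]
[cite: Wiles1995Annals, §2.1 (U_q ∈ 𝕋′_𝔪), Thm. 2.1] -/
def OldCongruenceMatches (E : WeierstrassCurve ℚ) (N₀ p s : ℕ) [NeZero N₀] [Fact p.Prime]
    (π : HeckeRing0 N₀ 2 →+* ZMod (p ^ s)) : Prop :=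
  (∀ (r : ℕ) (hr : r.Prime), r ≠ p →
      π (HeckeRing0.T N₀ 2 r hr) = ((E.LFunction r : ℤ) : ZMod (p ^ s))) ∧
    π (HeckeRing0.T N₀ 2 p (Fact.out : p.Prime)) =
      ((E.LFunction p : ℤ) : ZMod (p ^ s)) * (1 + (p : ZMod (p ^ s)))

/-- The level-`N` ideal `I = (m, T_r − a_r(E) : r prime) ⊂ 𝕋(N)` (`m = p^s`): the eigen-ideal
`I_f` of the newform of `E` plus `(p^s)`, so that `𝕋(N)/I = ℤ/p^s` and
`Λ_N/IΛ_N = Ta_𝔪J₀(N)/(I_f, p^s) ≅ E_opt[p^s]` under multiplicity one.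
[cite: DarmonDiamondTaylor1995, §4.2 (p. 108) `I_f`] -/
def eigenIdeal (E : WeierstrassCurve ℚ) (N : ℕ) [NeZero N] (m : ℕ) : Ideal (HeckeRing0 N 2) :=
  Ideal.span (insert ((m : ℕ) : HeckeRing0 N 2)
    {t | ∃ (r : ℕ) (hr : r.Prime), t = HeckeRing0.T N 2 r hr - ((E.LFunction r : ℤ) : HeckeRing0 N 2)})

/-- The `u`-STABILISED `p`-OLD PROJECTION `ψ^u = α_* − u·β_* : S₂(Γ₀(N₀p))^∨ → S₂(Γ₀(N₀))^∨`,
`u = a_p(E) = E.LFunction p ∈ {±1}` (transposes of the two degeneracy maps `τ ↦ τ`, `τ ↦ pτ`; it carries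
`H₁(X₀(N₀p), ℤ)` into `H₁(X₀(N₀), ℤ)` by the tree's `dualMap_degeneracyMap0_mem_periodHomology`, `u ∈ ℤ`).
Normalisation (critic V98 §2.3, confirmed): `β_*` is the `d = p` dual degeneracy map,
`α_*U_p = T_pα_* − β_*`, `β_*U_p = pα_*`, whence `ψ^u(U_p − u) = (T_p − u(1+p))α_* + (u² − 1)β_* =
(T_p − u(1+p))α_*` — killed by `π(T_p) = u(1+p)`.  For split `E` (`u = +1`, the classical frame) this is
the plain `α_* − β_*` of rev 1.0; for non-split `E` (`u = −1`, sign frame with `(d₁/p) = −1`) the plain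
difference is NOT compatible with `I` (`(α_* − β_*)(U_p + 1) ≡ −2(pα_* + β_*)`), hence the `u`.
[cite: DarmonDiamondTaylor1995, Lemma 4.28 (p. 135)] [cite: Ribet1990Inventiones, §3] -/
noncomputable def oldProjection (E : WeierstrassCurve ℚ) (N₀ p : ℕ) [NeZero N₀] [NeZero p]
    [NeZero (N₀ * p)] :
    Module.Dual ℂ (CuspForm (Gamma0 (N₀ * p)) 2) →ₗ[ℂ] Module.Dual ℂ (CuspForm (Gamma0 N₀) 2) :=
  (degeneracyMap0 N₀ (N₀ * p) 1 2).dualMap -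
    ((E.LFunction p : ℤ) : ℂ) • (degeneracyMap0 N₀ (N₀ * p) p 2).dualMap

/-- (compat) `ψ(I·Λ_N) ⊆ I_s·Λ_{N₀}` — `ψ` induces a map `ψ̄_s : Λ_N/IΛ_N → Λ_{N₀}/I_sΛ_{N₀}`
(`I = eigenIdeal E N (p^s)`, `I_s = ker π`).  The lemma to name (critic V98 P4): for `q ≠ p` (incl.
`q ∣ N₀`) the level-`N` operator `T_q`/`U_q` COMMUTES with both `p`-degeneracy transposes,
`α_*T_q^{(N)} = T_q^{(N₀)}α_*`, `β_*T_q^{(N)} = T_q^{(N₀)}β_*` (double cosets at `q` and `p` commute,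
`(q, p) = 1`); at `p`: `α_*U_p = T_pα_* − β_*`, `β_*U_p = pα_*`.
[cite: DarmonDiamondTaylor1995, Lemma 4.28, §4.5 p. 137] [cite: Ribet1990Inventiones, §3 (3.2)–(3.4)] -/
def OldProjectionCompat (E : WeierstrassCurve ℚ) (N₀ p s : ℕ) [NeZero N₀] [Fact p.Prime]
    [NeZero (N₀ * p)] (π : HeckeRing0 N₀ 2 →+* ZMod (p ^ s)) : Prop :=
  ∀ z ∈ eigenIdeal E (N₀ * p) (p ^ s) • periodHomologyHecke (N₀ * p),
    oldProjection E N₀ p z ∈ RingHom.ker π • periodHomologyHecke N₀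

/-- (inj) `ψ̄_s : Λ_N/IΛ_N → Λ_{N₀}/I_sΛ_{N₀}` is injective (elementwise).  Content: both sides have
order `p^{2s}` (freeness of `Ta_𝔪J₀(N)` over `𝕋(N)_𝔪` at `p ∥ N`, `U_p ∉ 𝔪`, `ρ̄_𝔪` irreducible —
Wiles 1995 Thm 2.1 / DDT Thm 4.26 (b); and of `Ta_{𝔪₀}J₀(N₀)` over `𝕋(N₀)_{𝔪₀}`, case (a); at a
multiplicative `q ∥ N₀` of the sign frame with `ρ̄` unramified at `q` and `q ≡ ±1 [p]` multiplicity one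
is the PRICE (q) again) and `ψ̄_s` is onto.  [cite: Wiles1995Annals, Thm. 2.1]
[cite: DarmonDiamondTaylor1995, Thm. 4.26] [cite: Tilouine1997Gorenstein, Thm. 3.4]
[cite: MazurRibet1991Asterisque, Main Theorem (multiplicity one at q ∥ N)] -/
def OldProjectionInj (E : WeierstrassCurve ℚ) (N₀ p s : ℕ) [NeZero N₀] [Fact p.Prime]
    [NeZero (N₀ * p)] (π : HeckeRing0 N₀ 2 →+* ZMod (p ^ s)) : Prop :=
  ∀ z ∈ periodHomologyHecke (N₀ * p),
    oldProjection E N₀ p z ∈ RingHom.ker π • periodHomologyHecke N₀ →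
      z ∈ eigenIdeal E (N₀ * p) (p ^ s) • periodHomologyHecke (N₀ * p)

/-- (surj) `ψ̄_s` is onto (elementwise): Ihara's lemma at the non-Eisenstein maximal ideal
`𝔪₀ = π⁻¹(p) ∩ 𝕋̃` (apply `ribet1984_iharaLemma` to the pair `(y, 0)` and invert the unit `π(s)`).
[cite: Ribet1984ICM, Thm. 4.1] [cite: DarmonDiamondTaylor1995, Lemma 4.28 (a), 4.30 (b)] -/
def OldProjectionSurj (E : WeierstrassCurve ℚ) (N₀ p s : ℕ) [NeZero N₀] [Fact p.Prime]
    [NeZero (N₀ * p)] (π : HeckeRing0 N₀ 2 →+* ZMod (p ^ s)) : Prop :=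
  ∀ y ∈ periodHomologyHecke N₀, ∃ z ∈ periodHomologyHecke (N₀ * p),
    oldProjection E N₀ p z - y ∈ RingHom.ker π • periodHomologyHecke N₀

/-- CLASSICAL ABSORPTION AT DEPTH `s` for `W` and `p` (rev 1.1 currency = the inner shape of the S1b
consumer's `hJmax`, critic V98 P2): for every imaginary quadratic `K` with the Heegner hypothesis for
`N_W`, every parametrisation datum, orientation, embedding, square-free `n`, if every `ℓ ∣ n` is a
Kolyvagin prime with `s ≤ M(ℓ) = Zhang2014.kolyvaginIndex W p ℓ`, then `p^s ∣ P(n)` in `W(K[n])`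
(`PDiv d p s`; exact divisibility, no torsion slack: `W(K[n])[p] = 0` under `Surj`, Gross 1991 Lemma 4.3).
[cite: GrossLMS1991, §3–§4 (4.1), Lemma 4.3] [cite: McCallumLMS1991, §5 (p^M ∣ P_n)]
[cite: Jetchev2008, Thm 1.4] -/
def AbsorptionAt (W : WeierstrassCurve ℚ) [W.IsElliptic] [W.IsGloballyMinimal] (p s : ℕ)
    [Fact p.Prime] : Prop :=
  ∀ [NeZero (W.conductorNorm ℤ)] (K : Type) [Field K] [NumberField K], IsImaginaryQuadratic K →
    SatisfiesHeegnerHypothesis (W.conductorNorm ℤ) K →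
    ∀ (Dt : ModularParametrizationData W (W.conductorNorm ℤ)) (β : ℤ) (ι : K →+* ℂ) (n : ℕ)
      (d : KolyvaginHeegnerData Dt β ι n), Squarefree n →
      (∀ ℓ ∈ n.primeFactors, Zhang2014.IsKolyvaginPrime (W.conductorNorm ℤ) W K p ℓ ∧
        s ≤ Zhang2014.kolyvaginIndex W p ℓ) →
      PDiv d p s

/-- The `χ`-TWISTED DERIVED POINT `P^χ(m) = Σ_{τ ∈ S} χ(τ)·τ(D_m y(m)) ∈ E(K[m])` of a Kolyvagin–Heegner
datum of `E` and a sign function `χ` on `Aut(K[m])` (for a genus character `χ` of `K`, trivial on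
`G_m = Gal(K[m]/K[1])`, this is the genus component used by genus-p2's `GenusHeegnerSettingRC.hP`,
`Σ_τ s(τ)·τ y`, derived à la Kolyvagin; `χ = 1` gives the tree's `d.derivedPoint`, `chiTwistedDerivedPoint_one`).
[cite: GrossLMS1991, §4 (4.1)] [cite: GrossZagier1986, §IV.1 (genus class characters)] -/
noncomputable def chiTwistedDerivedPoint {N : ℕ} [NeZero N] {E : WeierstrassCurve ℚ} {K : Type}
    [Field K] [NumberField K] {Dt : ModularParametrizationData E N} {β : ℤ} {ι : K →+* ℂ} {m : ℕ}
    (d : KolyvaginHeegnerData Dt β ι m)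
    (χ : (ringClassField K ι m ≃ₐ[ℚ] ringClassField K ι m) → ℤˣ) :
    (E.baseChange (ringClassField K ι m)).toAffine.Point :=
  ∑ τ ∈ d.S, ((χ τ : ℤˣ) : ℤ) •
    pointGalHom E (ringClassField K ι m) τ
      (KolyvaginOperator.derivOpProd (pointGalHom E (ringClassField K ι m)) d.σ m.primeFactorsList d.y)

/-- GENUS ∕ `χ`-ABSORPTION AT DEPTH `s` for `E`, `p` and the discriminant `d₁` (item 23444's currency on
the `E′`-side, critic V98 P1 (b)): for every imaginary quadratic `K` in which `p` is unramified (hence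
split, as `4N ∣ β² − d_K` and `p ∣ N`), every datum of `E` over `K` of square-free conductor `m` whose
primes are Kolyvagin primes of index `≥ s`, every square root `θ ∈ K[1]` of `d₁` inside `K[m]` and every
sign function `χ` with `σθ = χ(σ)θ` on `Gal(K[m]/K)` (the genus character of `K(√d₁)/K`), the
`χ`-twisted derived point is `p^s`-divisible in `E(K[m])`.  (Ramified primes `q ∥ N_E` of `K` are
allowed by `KolyvaginHeegnerData`; for `d₁` a square, `θ ∈ ℚ`, `χ = 1` it is `AbsorptionAt` without the
Heegner-hypothesis binder.)  [cite: GrossLMS1991, Prop. 3.6, §4 (4.1)] [cite: GrossZagier1986, §IV.1]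
[cite: Jetchev2008, Thm 1.4] -/
def AbsorptionAtChi (E : WeierstrassCurve ℚ) [E.IsElliptic] [E.IsGloballyMinimal] (p s : ℕ) (d₁ : ℤ)
    [Fact p.Prime] : Prop :=
  ∀ [NeZero (E.conductorNorm ℤ)] (K : Type) [Field K] [NumberField K], IsImaginaryQuadratic K →
    ¬ (p : ℤ) ∣ NumberField.discr K →
    ∀ (Dt : ModularParametrizationData E (E.conductorNorm ℤ)) (β : ℤ) (ι : K →+* ℂ) (m : ℕ)
      (d : KolyvaginHeegnerData Dt β ι m), Squarefree m →
      (∀ ℓ ∈ m.primeFactors, Zhang2014.IsKolyvaginPrime (E.conductorNorm ℤ) E K p ℓ ∧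
        s ≤ Zhang2014.kolyvaginIndex E p ℓ) →
      ∀ (θ : ringClassField K ι m) (χ : (ringClassField K ι m ≃ₐ[ℚ] ringClassField K ι m) → ℤˣ),
        θ ^ 2 = ((d₁ : ℤ) : ringClassField K ι m) → (θ : ℂ) ∈ ringClassField K ι 1 →
        (∀ σ ∈ ringClassGal ι m, σ θ = (((χ σ : ℤˣ) : ℤ) : ringClassField K ι m) * θ) →
        ∃ Q : (E.baseChange (ringClassField K ι m)).toAffine.Point,
          ((p ^ s : ℕ) : ℤ) • Q = chiTwistedDerivedPoint d χ

/-- THE `hJmax` BODY AT ONE CURVE (critic V98 P3): verbatim the binder `hJmax` of the tree's S1b consumer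
`res_pOnlyMultCarrierAtFive_of_jetchevMaxHL_of_hlTwinLowerSupplyAt` (`Cruxes/…/Lines/ramified_twin.lean`)
with its leading `∀ (W …) (p) [Fact p.Prime]` instantiated — the inner consumer
`missingUpperBoundAt_of_classX11b_of_surj_of_monoCarrier_of_jetchevMaxHL_of_hlTwinLowerSupply` applies
`hJmax` ONLY at the curve `W` in hand (l.273), so keying its hypothesis per curve is a copy-edit.
[cite: Jetchev2008, Thm 1.4 (p. 812)] [cite: McCallumLMS1991, §5] -/
def JetchevMaxHLAt (W : WeierstrassCurve ℚ) [W.IsElliptic] [W.IsGloballyMinimal] (p : ℕ)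
    [Fact p.Prime] : Prop :=
  ∀ [NeZero (W.conductorNorm ℤ)] (K : Type) [Field K] [NumberField K]
    (Dt : ModularParametrizationData W (W.conductorNorm ℤ)) (β : ℤ) (ι : K →+* ℂ),
    5 ≤ p → W.analyticRank = 1 → W.HasMultiplicativeReductionAtPrime p → Surj W p →
    IsImaginaryQuadratic K → SatisfiesHeegnerHypothesis (W.conductorNorm ℤ) K →
    Odd (NumberField.discr K) → NumberField.discr K < -4 →
    (W.quadraticTwist (NumberField.discr K : ℚ)).entireLFunction 1 ≠ 0 →
    (4 * (W.conductorNorm ℤ : ℤ)) ∣ β ^ 2 - NumberField.discr K → ¬ (p : ℤ) ∣ Dt.c →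
    ∀ (v : HeightOneSpectrum (𝓞 ℚ)) (s : ℕ), s ≤ padicValNat p (W.tamagawaNumberAt v) →
      ∀ (n : ℕ) (d : KolyvaginHeegnerData Dt β ι n), Squarefree n →
        (∀ ℓ ∈ n.primeFactors, Zhang2014.IsKolyvaginPrime (W.conductorNorm ℤ) W K p ℓ ∧
          s ≤ Zhang2014.kolyvaginIndex W p ℓ) → PDiv d p s

/-- `hJmax` ON THE CLASSICAL FRAME: for every globally minimal `W` and prime `p` which is the ONLY
multiplicative prime of `W` and SPLIT (the two frame binders of S1b of item 19715, verbatim), the `hJmax`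
body holds at `W`.  This is what `CarrierOldCongruenceAbsorption` delivers
(`jetchevMaxHLAtFrame_of_carrierOldCongruenceAbsorption`), and what S1b consumes together with the supply.
[cite: Jetchev2008, Thm 1.4 and Hypothesis (∗)] -/
def JetchevMaxHLAtFrame : Prop :=
  ∀ (W : WeierstrassCurve ℚ) [W.IsElliptic] [W.IsGloballyMinimal] (p : ℕ) [Fact p.Prime],
    (∀ (ℓ : ℕ) [Fact ℓ.Prime], W.HasMultiplicativeReductionAtPrime ℓ → ℓ = p) →
    W.HasSplitMultiplicativeReductionAtPrime p → JetchevMaxHLAt W p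

/-! ## §1 The statements of the line (as `Prop`s) and the two targets -/

/-- S1 — OLD CONGRUENCE OF DEPTH `s`: in the lowering frame, `𝕋(N₀) → ℤ/p^s` matching `E` exists.
Proof inputs: `E[p^s]` finite flat over `ℤ_p` ⟺ `p^s ∣ ord_pΔ_min` (Tate curve; an unramified quadratic
twist for non-split `E`); `ρ̄` modular of type `Σ = {q ∣ N₀}`; `φ_Σ : R_Σ ≅ 𝕋_Σ = 𝕋′(N_Σ)_{𝔪₀}`
(Diamond 1996; `ρ̄|_{ℚ(√p*)}` irreducible ⇐ Surj, `p ≥ 5`); `T_p ↦ u + pu⁻¹ = a_p(E)(1+p)`; `N_Σ = N₀` and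
`U_q ↦ a_q(E)` as in the notes (a) of `OldCongruenceMatches` — automatic in the classical frame (every
`q ∣ N₀` additive), PRICE (q) at a multiplicative `q ∥ N₀` with `ρ̄` unramified at `q` (sign frame).
Size M given the print facts (none typed in the tree yet).
[cite: Diamond1996Annals, Thm 1.1] [cite: CSS1997Diamond, Thm 6.1, Lemma 3.2]
[cite: Khare2003Invent, Prop. 3] [cite: DahmenYazdani2012, Prop. 6 / Thm 2 (arXiv:1009.0284)] -/
def OldCongruenceDepth : Prop :=
  ∀ (E : WeierstrassCurve ℚ) [E.IsElliptic] [E.IsGloballyMinimal] (N₀ p s : ℕ) [NeZero N₀]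
    [Fact p.Prime], LoweringFrame E N₀ p s →
    ∃ π : HeckeRing0 N₀ 2 →+* ZMod (p ^ s), OldCongruenceMatches E N₀ p s π

/-- S2 — THE OLD PROJECTION IS A BIJECTION MODULO (`I`, `I_s`) (the `𝕋`-half of `ψ̄`; elementwise:
compat ∧ inj ∧ surj), in the lowering frame.  Inputs: `wiles1995_multiplicityOne` (a) and (b),
`ribet1984_iharaLemma`, the Hecke/degeneracy relations incl. `α_*U_p = T_pα_* − β_*`, `β_*U_p = pα_*`
and the `q ≠ p` commutation, and the rank count turning `dim J[𝔪] = 2` into freeness of `Ta_𝔪`.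
Numerically falsifiable by modular symbols (`(N₀,p,s) = (11,5,1)`: LEAD ∕ kit seat).  Size M–L.
[cite: Wiles1995Annals, Thm. 2.1] [cite: Ribet1984ICM, Thm. 4.1]
[cite: DarmonDiamondTaylor1995, Thm. 4.26, Lemma 4.28, 4.30] -/
def OldProjectionBijective : Prop :=
  ∀ (E : WeierstrassCurve ℚ) [E.IsElliptic] [E.IsGloballyMinimal] (N₀ p s : ℕ) [NeZero N₀]
    [Fact p.Prime] [NeZero (N₀ * p)], LoweringFrame E N₀ p s →
    ∀ π : HeckeRing0 N₀ 2 →+* ZMod (p ^ s), OldCongruenceMatches E N₀ p s π →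
      OldProjectionCompat E N₀ p s π ∧ OldProjectionInj E N₀ p s π ∧ OldProjectionSurj E N₀ p s π

/-- S3 — KUMMER DESCENT ALONG THE OLD PROJECTION, CLASSICAL FRAME (Galois half; named fact modulo
vocabulary — needs D1 = the `ℚ`-structures of `J₀(N₀p)`, `J₀(N₀)` with Galois-equivariant degeneracy maps
and Kummer classes of `F`-rational points with coefficients in a `𝕋`-quotient of `J₀[p^s]`, D2 = CM points
of both levels over ring class fields): given a matching `π` and (compat, inj, surj), every Kolyvagin
layer all of whose primes have index `≥ s` is `p^s`-divisible.  Steps (i)–(v) as in the module docstring,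
with `u = a_p(W) = +1`.  Implied by S3χ (`kummerDescentAlongOldProjection_of_chi`).  Size L (mostly vocabulary).
[cite: GrossLMS1991, Prop. 3.6, Prop. 3.7 (1), §4 (4.1), Lemma 4.3]
[cite: GrossZagier1986, §II.1 / Gross1984HeegnerPoints, §§4–6 (degeneracy on CM points)]
[cite: DarmonDiamondTaylor1995, §1.7 Def. 1.44, Lemma 1.46] -/
def KummerDescentAlongOldProjection : Prop :=
  ∀ (W : WeierstrassCurve ℚ) [W.IsElliptic] [W.IsGloballyMinimal] (N₀ p s : ℕ) [NeZero N₀]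
    [Fact p.Prime] [NeZero (N₀ * p)], FrameAt W N₀ p s →
    ∀ π : HeckeRing0 N₀ 2 →+* ZMod (p ^ s), OldCongruenceMatches W N₀ p s π →
      OldProjectionCompat W N₀ p s π → OldProjectionInj W N₀ p s π → OldProjectionSurj W N₀ p s π →
      AbsorptionAt W p s

/-- S3χ — KUMMER DESCENT ALONG THE `u`-STABILISED OLD PROJECTION, SIGN FRAME (Galois half for the genus
service; named fact modulo the same vocabulary D1/D2, the CM points now with a ramified `𝔮 ∣ 𝔫₀` allowed):
with `u = a_p(E)` and `ψ^u = α_* − uβ_*` (`oldProjection E N₀ p`): `ψ^u(P̃^χ_m) = (1 − uσ_𝔭^{∓1})P̃′^χ_m`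
(`σ_𝔭` commutes with `D_m` and the `τ ∈ S`), the class of `P̃′^χ_m` modulo `I_s` is `χ`-isotypic under `Gal(K[m]/K)` (Gross
Prop. 3.6 with coefficients `J₀(N₀)[p^s]/I_s`; `θ ∈ K[1]` makes `χ` trivial on `G_m`), and
`χ(σ_𝔭) = (d₁/p)` (Frobenius of the degree-one prime `𝔭 ∣ p` on `√d₁`, `p ∤ d₁`), so the factor is
`1 − a_p(E)(d₁/p) = 0` by `FrameAtSign.sign`; then (iv)–(v) as in S3.  Size L.
[cite: GrossLMS1991, Prop. 3.6, Prop. 3.7 (1), §4 (4.1)] [cite: GrossZagier1986, §IV.1]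
[cite: DarmonDiamondTaylor1995, §1.7 Def. 1.44, Lemma 1.46, Lemma 4.28] -/
def KummerDescentAlongOldProjectionChi : Prop :=
  ∀ (E : WeierstrassCurve ℚ) [E.IsElliptic] [E.IsGloballyMinimal] (N₀ p s : ℕ) (d₁ : ℤ) [NeZero N₀]
    [Fact p.Prime] [NeZero (N₀ * p)], FrameAtSign E N₀ p s d₁ →
    ∀ π : HeckeRing0 N₀ 2 →+* ZMod (p ^ s), OldCongruenceMatches E N₀ p s π →
      OldProjectionCompat E N₀ p s π → OldProjectionInj E N₀ p s π → OldProjectionSurj E N₀ p s π →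
      AbsorptionAtChi E p s d₁

/-- THE CLASSICAL TARGET (card `carrier-old-congruence-absorption`, First lemma — uniform in the depth,
rev 1.1 currency): in the classical frame, EVERY depth `s ≤ t = ord_p c_p` is absorbed on every Kolyvagin
layer of index `≥ s`: `p^s ∣ P(n)` in `W(K[n])`.  Feeds S1b of item 19715 through
`jetchevMaxHLAtFrame_of_carrierOldCongruenceAbsorption`.  [cite: Jetchev2008, Thm 1.4]
[cite: McCallumLMS1991, §5] -/
def CarrierOldCongruenceAbsorption : Prop :=
  ∀ (W : WeierstrassCurve ℚ) [W.IsElliptic] [W.IsGloballyMinimal] (N₀ p s : ℕ) [NeZero N₀]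
    [Fact p.Prime] [NeZero (N₀ * p)], FrameAt W N₀ p s → AbsorptionAt W p s

/-- THE GENUS TARGET (item 23444's residual (b) on the `E′`-side): in the sign frame, the `χ`-twisted
derived points of `E` of every depth-`≥ s` conductor are `p^s`-divisible.  The pen's transport to clause
(D) of `padicValNat_card_sha_add_le_of_ringClassRationalEprimePoints` (`p^{M−t}·c_M(P_m) = 0` on the
`W`-side) is `Φ`-additivity plus Gross Prop. 4.7 (1) (`kolyvaginClass_eq_zero_iff`), once genus v1.3 fixes
its points `Pn m` as `Φ(P^χ(m))`.  [cite: Jetchev2008, Thm 1.4] [cite: GrossLMS1991, Prop. 4.7 (1)] -/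
def CarrierOldCongruenceAbsorptionChi : Prop :=
  ∀ (E : WeierstrassCurve ℚ) [E.IsElliptic] [E.IsGloballyMinimal] (N₀ p s : ℕ) (d₁ : ℤ) [NeZero N₀]
    [Fact p.Prime] [NeZero (N₀ * p)], FrameAtSign E N₀ p s d₁ → AbsorptionAtChi E p s d₁

/-! ## §2 Stubs (the only sorries of the file) -/

/-- stub S1. [cite: Diamond1996Annals, Thm 1.1] -/
theorem stub_oldCongruenceDepth : OldCongruenceDepth := by
  sorry

/-- stub S2. [cite: Wiles1995Annals, Thm. 2.1] [cite: Ribet1984ICM, Thm. 4.1] -/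
theorem stub_oldProjectionBijective : OldProjectionBijective := by
  sorry

/-- stub S3 (classical frame; also a corollary of stub S3χ, `kummerDescentAlongOldProjection_of_chi`).
[cite: GrossLMS1991, Prop. 3.6–3.7] -/
theorem stub_kummerDescentAlongOldProjection : KummerDescentAlongOldProjection := by
  sorry

/-- stub S3χ (sign frame). [cite: GrossLMS1991, Prop. 3.6–3.7] [cite: GrossZagier1986, §IV.1] -/
theorem stub_kummerDescentAlongOldProjectionChi : KummerDescentAlongOldProjectionChi := by
  sorry

/-! ## §3 Frame bridges (proved) -/

/-- Place ↔ prime bridge for SPLIT multiplicative reduction (copy of the private bridge of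
`…Lines/ramified_twin.lean` ∕ `…JetchevMaxHLAtPConsumer` §4). [folklore] -/
private theorem hasSplitMultiplicativeReductionAt_of_atPrime (W : WeierstrassCurve ℚ) [W.IsElliptic]
    (v : HeightOneSpectrum (𝓞 ℚ)) (p : ℕ) [Fact p.Prime] (hv : (Rat.HeightOneSpectrum.primesEquiv v : ℕ) = p)
    (h : W.HasSplitMultiplicativeReductionAtPrime p) : W.HasSplitMultiplicativeReductionAt v := by
  subst hv
  exact (hasSplitMultiplicativeReductionAtPrime_iff_hasSplitMultiplicativeReductionAt W v).mp h

/-- In the classical frame the place of `p` is the UNIQUE split multiplicative place, so it carries all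
of `ord_p ∏c`, and `c_p = ord_pΔ_min`: `ord_p Tam(W) = ord_p(ord_pΔ_min(W))`.
[cite: SilvermanATAEC1994, Cor. IV.9.2 (d)] -/
theorem padicValNat_tamagawaProduct_eq_of_only_split (W : WeierstrassCurve ℚ) [W.IsElliptic]
    [W.IsGloballyMinimal] (p : ℕ) [Fact p.Prime] (hp5 : 5 ≤ p)
    (honly : ∀ (ℓ : ℕ) [Fact ℓ.Prime], W.HasMultiplicativeReductionAtPrime ℓ → ℓ = p)
    (hsplit : W.HasSplitMultiplicativeReductionAtPrime p) :
    padicValNat p W.tamagawaProduct = padicValNat p (padicValInt p W.minimalDiscriminantInt) := by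
  have hp : p.Prime := Fact.out
  set v₀ : HeightOneSpectrum (𝓞 ℚ) := (Rat.HeightOneSpectrum.primesEquiv (R := 𝓞 ℚ)).symm ⟨p, hp⟩
    with hv₀_def
  have hv₀ : (Rat.HeightOneSpectrum.primesEquiv v₀ : ℕ) = p := by rw [hv₀_def, Equiv.apply_symm_apply]
  have hs₀ : W.HasSplitMultiplicativeReductionAt v₀ :=
    hasSplitMultiplicativeReductionAt_of_atPrime W v₀ p hv₀ hsplit
  have huniq : ∀ v, W.HasSplitMultiplicativeReductionAt v → v = v₀ := by
    intro v hv
    haveI : Fact (Rat.HeightOneSpectrum.primesEquiv v : ℕ).Prime := ⟨(Rat.HeightOneSpectrum.primesEquiv v).2⟩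
    have hmv : W.HasMultiplicativeReductionAtPrime (Rat.HeightOneSpectrum.primesEquiv v : ℕ) :=
      (hasMultiplicativeReductionAtPrime_primesEquiv_iff_holds W v
        (Rat.HeightOneSpectrum.primesEquiv v : ℕ) rfl).mpr hv.hasMultiplicativeReductionAt
    have hq : (Rat.HeightOneSpectrum.primesEquiv v : ℕ) = p := honly _ hmv
    apply (Rat.HeightOneSpectrum.primesEquiv (R := 𝓞 ℚ)).injective
    rw [hv₀_def, Equiv.apply_symm_apply]
    exact Subtype.ext hq
  rw [← CornerLocal.padicValNat_tamagawaNumberAt_eq_of_unique_split W p hp5 hs₀ huniq,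
    CornerLocal.tamagawaNumberAt_eq_ordMinimalDiscriminant_of_split W hs₀,
    LocalTorsionMult.ordMinimalDiscriminant_eq_padicValInt W v₀ hv₀]

/-- Classical frame ⇒ lowering frame (split ⇒ multiplicative; `s ≤ ord_p Tam = ord_p(ord_pΔ_min)` ⇒
`p^s ∣ ord_pΔ_min`). [cite: SilvermanATAEC1994, Cor. IV.9.2 (d)] -/
theorem FrameAt.toLoweringFrame {W : WeierstrassCurve ℚ} [W.IsElliptic] [W.IsGloballyMinimal]
    {N₀ p s : ℕ} [Fact p.Prime] (hF : FrameAt W N₀ p s) : LoweringFrame W N₀ p s where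
  five_le := hF.five_le
  not_dvd := hF.not_dvd
  cond := hF.cond
  surj := hF.surj
  mult := hF.split.hasMultiplicativeReductionAtPrime
  depth := by
    have h : s ≤ padicValNat p (padicValInt p W.minimalDiscriminantInt) := by
      rw [← padicValNat_tamagawaProduct_eq_of_only_split W p hF.five_le hF.only hF.split]
      exact hF.depth
    exact (pow_dvd_pow p h).trans pow_padicValNat_dvd

/-- Classical frame ⇒ sign frame with `d₁ = 1` (`a_p(W) = +1` at a split prime, `(1/p) = 1`).
[cite: SilvermanAEC2009, Ex. 8.19(a)] -/
theorem FrameAt.toFrameAtSign_one {W : WeierstrassCurve ℚ} [W.IsElliptic] [W.IsGloballyMinimal]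
    {N₀ p s : ℕ} [Fact p.Prime] (hF : FrameAt W N₀ p s) : FrameAtSign W N₀ p s 1 where
  toLoweringFrame := hF.toLoweringFrame
  sign := by
    rw [W.LFunction_apply_prime_of_hasSplitMultiplicativeReductionAtPrime p hF.split, legendreSym.at_one,
      mul_one]

/-- `P^1(m) = P(m)`: the trivially twisted derived point is the tree's derived point. [folklore] -/
theorem chiTwistedDerivedPoint_one {N : ℕ} [NeZero N] {E : WeierstrassCurve ℚ} {K : Type}
    [Field K] [NumberField K] {Dt : ModularParametrizationData E N} {β : ℤ} {ι : K →+* ℂ} {m : ℕ}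
    (d : KolyvaginHeegnerData Dt β ι m) : chiTwistedDerivedPoint d 1 = d.derivedPoint := by
  unfold chiTwistedDerivedPoint KolyvaginHeegnerData.derivedPoint KolyvaginOperator.derivedPoint
  refine Finset.sum_congr rfl fun τ _ => ?_
  simp only [Pi.one_apply, Units.val_one, one_zsmul]

/-- `χ = 1` SPECIALISATION: genus absorption with `d₁ = 1` implies classical absorption, for `p ∣ N_E`
(the Heegner hypothesis then makes `p` split, in particular unramified, in `K`:
`not_dvd_discr_of_satisfiesHeegnerHypothesis`; take `θ = 1`, `χ = 1`). [folklore] -/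
theorem absorptionAt_of_absorptionAtChi_one {E : WeierstrassCurve ℚ} [E.IsElliptic]
    [E.IsGloballyMinimal] {p s : ℕ} [Fact p.Prime] (hpN : p ∣ E.conductorNorm ℤ)
    (h : AbsorptionAtChi E p s 1) : AbsorptionAt E p s := by
  intro _ K _ _ hK hH Dt β ι n d hn hℓ
  have hp : p.Prime := Fact.out
  have hpd : ¬ (p : ℤ) ∣ NumberField.discr K := not_dvd_discr_of_satisfiesHeegnerHypothesis hK hH hp hpN
  obtain ⟨Q, hQ⟩ := h K hK hpd Dt β ι n d hn hℓ 1 1 (by simp) (Subfield.one_mem _)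
    (fun σ _ => by simp)
  exact ⟨Q, by rw [hQ, chiTwistedDerivedPoint_one]⟩

/-- S3χ ⇒ S3 (the classical Kummer descent is the `d₁ = 1` case of the genus one). [folklore] -/
theorem kummerDescentAlongOldProjection_of_chi (h : KummerDescentAlongOldProjectionChi) :
    KummerDescentAlongOldProjection := by
  intro W _ _ N₀ p s _ _ _ hF π hπ hc hi hs
  have hpN : p ∣ W.conductorNorm ℤ := by rw [hF.cond]; exact dvd_mul_left p N₀
  have hχ : AbsorptionAtChi W p s 1 := h W N₀ p s 1 hF.toFrameAtSign_one π hπ hc hi hs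
  intro _ K _ _ hK hH Dt β ι n d hn hℓ
  exact absorptionAt_of_absorptionAtChi_one hpN hχ K hK hH Dt β ι n d hn hℓ

/-! ## §4 Compositions (kernel-checked) -/

/-- `S1 → S2 → S3 → CarrierOldCongruenceAbsorption` (pure logic + the frame bridge). [folklore] -/
theorem carrierOldCongruenceAbsorption_of (h₁ : OldCongruenceDepth) (h₂ : OldProjectionBijective)
    (h₃ : KummerDescentAlongOldProjection) : CarrierOldCongruenceAbsorption := by
  intro W _ _ N₀ p s _ _ _ hF
  obtain ⟨π, hπ⟩ := h₁ W N₀ p s hF.toLoweringFrame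
  obtain ⟨hc, hi, hs⟩ := h₂ W N₀ p s hF.toLoweringFrame π hπ
  exact h₃ W N₀ p s hF π hπ hc hi hs

/-- `S1 → S2 → S3χ → CarrierOldCongruenceAbsorptionChi` (pure logic). [folklore] -/
theorem carrierOldCongruenceAbsorptionChi_of (h₁ : OldCongruenceDepth) (h₂ : OldProjectionBijective)
    (h₃ : KummerDescentAlongOldProjectionChi) : CarrierOldCongruenceAbsorptionChi := by
  intro E _ _ N₀ p s d₁ _ _ _ hF
  obtain ⟨π, hπ⟩ := h₁ E N₀ p s hF.toLoweringFrame
  obtain ⟨hc, hi, hs⟩ := h₂ E N₀ p s hF.toLoweringFrame π hπ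
  exact h₃ E N₀ p s d₁ hF π hπ hc hi hs

/-- `S1 → S2 → S3χ → CarrierOldCongruenceAbsorption`: the genus stub also closes the classical target.
[folklore] -/
theorem carrierOldCongruenceAbsorption_of_chi (h₁ : OldCongruenceDepth) (h₂ : OldProjectionBijective)
    (h₃ : KummerDescentAlongOldProjectionChi) : CarrierOldCongruenceAbsorption :=
  carrierOldCongruenceAbsorption_of h₁ h₂ (kummerDescentAlongOldProjection_of_chi h₃)

/-- The classical target modulo stubs S1, S2, S3. [folklore] -/
theorem carrierOldCongruenceAbsorption_closed : CarrierOldCongruenceAbsorption :=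
  carrierOldCongruenceAbsorption_of stub_oldCongruenceDepth stub_oldProjectionBijective
    stub_kummerDescentAlongOldProjection

/-- The genus target modulo stubs S1, S2, S3χ. [folklore] -/
theorem carrierOldCongruenceAbsorptionChi_closed : CarrierOldCongruenceAbsorptionChi :=
  carrierOldCongruenceAbsorptionChi_of stub_oldCongruenceDepth stub_oldProjectionBijective
    stub_kummerDescentAlongOldProjectionChi

/-! ## §5 The `hJmax` glue (critic V98 P3; proved) -/

/-- **`CarrierOldCongruenceAbsorption → JetchevMaxHLAtFrame`**: on the classical frame the card's target
IS the `hJmax` input of S1b's consumer.  Bookkeeping: `N₀ := N_W / p` with `p ∤ N₀` (`f_p = 1` at a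
multiplicative prime, `factorization_conductorNorm_eq_one_of_hasMultiplicativeReductionAtPrime`), and
`s ≤ ord_p c_v ≤ ord_p ∏c` (`CornerLocal.padicValNat_tamagawaNumberAt_le`).
[cite: SilvermanATAEC1994, IV.10.2 (b), Cor. IV.9.2 (d)] [cite: Jetchev2008, Thm 1.4] -/
theorem jetchevMaxHLAtFrame_of_carrierOldCongruenceAbsorption (h : CarrierOldCongruenceAbsorption) :
    JetchevMaxHLAtFrame := by
  intro W _ _ p _ honly hsplit _ K _ _ Dt β ι hp5 _hr hmult hρ hK hHN _hodd _hlt _hL _hβ _hc v s hs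
    n d hn hℓ
  have hp : p.Prime := Fact.out
  have hN0 : W.conductorNorm ℤ ≠ 0 := (W.conductorNorm_pos_holds).ne'
  have hfac : (W.conductorNorm ℤ).factorization p = 1 :=
    W.factorization_conductorNorm_eq_one_of_hasMultiplicativeReductionAtPrime p hmult
  have hpN : p ∣ W.conductorNorm ℤ := by
    rw [hp.dvd_iff_one_le_factorization hN0, hfac]
  set N₀ : ℕ := W.conductorNorm ℤ / p with hN₀_def
  have hcond : W.conductorNorm ℤ = N₀ * p := (Nat.div_mul_cancel hpN).symm
  have hnot : ¬ p ∣ N₀ := by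
    intro hd
    have h2 : p ^ 2 ∣ W.conductorNorm ℤ := by
      rw [hcond, pow_two]
      exact mul_dvd_mul hd dvd_rfl
    have := (hp.pow_dvd_iff_le_factorization hN0).mp h2
    omega
  have hN₀0 : N₀ ≠ 0 := by
    intro h0
    rw [h0, zero_mul] at hcond
    exact hN0 hcond
  haveI : NeZero N₀ := ⟨hN₀0⟩
  haveI : NeZero (N₀ * p) := ⟨by rw [← hcond]; exact hN0⟩
  have hF : FrameAt W N₀ p s :=
    { five_le := hp5
      not_dvd := hnot
      cond := hcond
      surj := hρ
      split := hsplit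
      only := honly
      depth := hs.trans (CornerLocal.padicValNat_tamagawaNumberAt_le W p v) }
  exact h W N₀ p s hF K hK hHN Dt β ι n d hn hℓ

/-- Hence S1b's `hJmax` input on the classical frame, modulo stubs S1, S2, S3. [folklore] -/
theorem jetchevMaxHLAtFrame_closed : JetchevMaxHLAtFrame :=
  jetchevMaxHLAtFrame_of_carrierOldCongruenceAbsorption carrierOldCongruenceAbsorption_closed

end Summit.BirchSwinnertonDyer.BirchSwinnertonDyer.Cruxes.EulerHalfNotRamNoInertSetAtFive.CarrierAbsorption

/-! ## §6 (D)-TRANSPORT (rev 1.2): point divisibility ⟹ genus-p2's clause (D), kernel-checked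

Item 23444's S4♯ residual (b) is typed by genus-p2 (Theorems file
`ErratumRoadFiveEulerHalfGenusSharpKolyvaginCarrier`, glue `GenusSharpKolyvagin.padicValNat_card_sha_add_le_of_ringClassRationalEprimePoints`)
as the CLASS-LEVEL clause (D) «`p^{M−t} · c_M(P_m) = 0`» inside the ring-class-rational datum `hR`.  This
section proves, sorry-free and over built tree objects only, that (D) follows from the POINT-LEVEL clause
(D′) «`P_m ∈ p^{min(M,t)} · A_m`» — the currency in which THIS line's mechanism (S1 old congruence of depth `s`,
S2 `u`-stabilised old projection, S3χ Kummer descent) delivers its output (`AbsorptionAtChi`: `p^s ∣ P^χ(m)` in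
`E′(K[m])` for every `s ≤ min(M(ℓ), t)`), with no use of McCallum's Prop. 5.2 ∕ 4.4, no Cassels–Tate pairing and no
`X₀(N)`-keyed named fact:
* `zsmul_kolyvaginClass_eq_zero_of_zsmul_eq` — GENERIC (any field, any level): `P = a·R` with `R ∈ A` and
  `n ∣ a·b` ⟹ `b · c_n(P) = 0` (`b·c(P) = c(b·P)` by `cls_zsmul`, and `b·P = n·(kR) ∈ nA` kills the class,
  Gross 1991 Prop. 4.7 (1) "if" ∕ McCallum 1991 Cor. 4.5);
* `pow_sub_zsmul_kolyvaginClass_eq_zero_of_pointDiv` — at level `p^M`: `P ∈ p^{min(M,t)}A ⟹ p^{M−t}·c_M(P) = 0`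
  (`min(M,t) + (M ∸ t) = M`);
* `exists_mem_zsmul_eq_map_of_zsmul_eq` — the additive seam: divisibility is transported by ANY additive map
  `Φ` with `Φ(source) ⊆ A` (the twist isomorphism `E′ ⥲ W` over `K(√d₁) ⊆ K[1]` composed with `K[m] ↪ K̄`);
* `GenusKolyvaginEprimePointsRDiv` — genus-p2's `hR` body VERBATIM (sign, lift of conjugation, admissible
  RATIONAL modules, points, `P_1 = P`, eigen relation, McCallum 4.4 switch, (E′) at `v ∋ p`) with (D) replaced
  by (D′) `∃ R ∈ A m, p^{min M t} • R = Pn m`;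
* `padicValNat_card_sha_add_le_of_genusKolyvaginEprimePointsRDiv` — S4♭'s inequality
  `ord_p #Ш(W/K) + 2t ≤ 2·ord_p[W(K):ℤP]` from `hL` (verbatim) and the (D′)-datum: PROVED by rebuilding `hR`.
Why `min(M,t)` and not `t`: the `G_m`-invariance of `[D_m x′_m]` with coefficients mod `I_s` uses `p^s ∣ ℓ+1`
and `p^s ∣ a_ℓ` for the Kolyvagin primes `ℓ ∣ m`, which the level-`p^M` primes give only for `s ≤ M`.
On the 23444 frame the rev-1.1 PRICE (q) is VACUOUS: `jval : ¬ p ∣ ord_q j(W) = ord_q j(E′)` makes `ρ̄_{E′,p}`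
RAMIFIED at the multiplicative prime `q ∥ N_{E′}` (Tate), and at the additive primes `r ≠ p` of `N_{E′}/q`
(`p ≥ 5`) the conductor exponents of `ρ̄` and `ρ` agree (Carayol), so `N(ρ̄_{E′}) = N_{E′}/p = N₀` as S1/S2 assume;
the sign condition of `FrameAtSign E′ N₀ p s q*` is automatic: `a_p(E′)·(q*/p) = a_p(W) = +1` (`W` split at `p`,
`χ_{q*}` unramified at `p`).  NOT PROVED HERE: (D′) itself (it is `CarrierOldCongruenceAbsorptionChi` for
`E′ = W ⊗ χ_{q*}` at `s = min(M,t)` pushed through `Φ`, whose formal link waits for line `genus` v1.3 to fix its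
points `Pn m` as `Φ(P^χ(m))` — S2 of item 23444 made constructive).  [cite: GrossLMS1991, Prop. 4.7 (1), §4 (4.4)]
[cite: McCallumLMS1991, Cor. 4.5, §5] [cite: Jetchev2008, Thm 1.4, Cor. 1.5] -/

namespace Summit.BirchSwinnertonDyer.BirchSwinnertonDyer.Cruxes.EulerHalfNotRamNoInertSetAtFive.CarrierAbsorption

set_option linter.dupNamespace false
set_option autoImplicit false

section Transport

open scoped Classical

open WeierstrassCurve NumberField IsDedekindDomain Field
  Literature.NumberTheory.EllipticCurves Literature.NumberTheory.EllipticCurves.KolyvaginCocycle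
  Literature.NumberTheory.EllipticCurves.RingClassField
  Literature.NumberTheory.GaloisRepresentations Literature.NumberTheory.NumberFields
  Literature.NumberTheory.DiophantineGeometry
  Summit.BirchSwinnertonDyer.Rank1Residual.X11b
  Summit.BirchSwinnertonDyer.BirchSwinnertonDyer.Theorems

universe u

/-- **`P = a·R`, `R ∈ A`, `n ∣ a·b` ⟹ `b·c_n(P) = 0`** (generic Kolyvagin class, any field, any level):
`b·c(P) = c(b·P)` (`cls_zsmul`, Gross 1991 §4 (4.4)) and `b·P = (ab)·R = n·(kR) ∈ nA`, so the class dies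
(Gross 1991 Prop. 4.7 (1) "if" ∕ McCallum 1991 Cor. 4.5, `cls_eq_zero_of_mem`).
[cite: GrossLMS1991, Prop. 4.7 (1), §4 (4.4)] [cite: McCallumLMS1991, Cor. 4.5] -/
theorem zsmul_kolyvaginClass_eq_zero_of_zsmul_eq {K : Type u} [Field K] (V : WeierstrassCurve K)
    {n a b : ℤ} (hn : n ∣ a * b) {hdiv : ∀ P : geomPoints V, ∃ Q : geomPoints V, n • Q = P}
    {A : AddSubgroup (geomPoints V)} (hA : IsAdmissible (absoluteGaloisGroup K) A n)
    {P : geomPoints V} (hP : P ∈ invPoints (absoluteGaloisGroup K) A n)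
    {R : geomPoints V} (hR : R ∈ A) (hRP : a • R = P) :
    b • kolyvaginClass V n hdiv hA P hP = 0 := by
  obtain ⟨k, hk⟩ := hn
  obtain ⟨Q, hQ⟩ := hdiv P
  have hbP : b • P ∈ invPoints (absoluteGaloisGroup K) A n := AddSubgroup.zsmul_mem _ hP b
  have hbQ : n • (b • Q) = b • P := by rw [smul_comm, hQ]
  rw [kolyvaginClass_eq_cls hA hP hQ, ← cls_zsmul hA _ hP hQ b hbP hbQ]
  refine cls_eq_zero_of_mem hA _ hbP hbQ ⟨k • R, A.zsmul_mem hR k, ?_⟩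
  rw [← mul_smul, ← hk, mul_comm, mul_smul, hRP]

/-- **(D′) ⟹ (D) at level `p^M`**: `P ∈ p^{min(M,t)}·A ⟹ p^{M−t}·c_M(P) = 0` (truncated subtraction:
`min(M,t) + (M ∸ t) = M`; for `t > M` the hypothesis says `P ∈ p^M A` and the class itself vanishes).
[cite: GrossLMS1991, Prop. 4.7 (1)] [cite: Jetchev2008, Thm 1.4, Cor. 1.5] -/
theorem pow_sub_zsmul_kolyvaginClass_eq_zero_of_pointDiv {K : Type u} [Field K] (V : WeierstrassCurve K)
    {p M t : ℕ} {hdiv : ∀ P : geomPoints V, ∃ Q : geomPoints V, ((p ^ M : ℕ) : ℤ) • Q = P}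
    {A : AddSubgroup (geomPoints V)} (hA : IsAdmissible (absoluteGaloisGroup K) A ((p ^ M : ℕ) : ℤ))
    {P : geomPoints V} (hP : P ∈ invPoints (absoluteGaloisGroup K) A ((p ^ M : ℕ) : ℤ))
    (hD : ∃ R ∈ A, ((p ^ min M t : ℕ) : ℤ) • R = P) :
    ((p : ℤ) ^ (M - t)) • kolyvaginClass V _ hdiv hA P hP = 0 := by
  obtain ⟨R, hR, hRP⟩ := hD
  have h : min M t + (M - t) = M := by omega
  refine zsmul_kolyvaginClass_eq_zero_of_zsmul_eq V ⟨1, ?_⟩ hA hP hR hRP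
  simp only [Nat.cast_pow, ← pow_add, h, mul_one]

/-- **The additive seam**: an additive map `Φ` with `Φ(source) ⊆ A` transports `k`-divisibility of `x` to
`Φ x ∈ k·A` (used with `Φ` = twist isomorphism `E′(K[m]) ⥲ W(K[m])` composed with `W(K[m]) ↪ W(K̄)` along
`emb m`, `A = A_m`, `x = P^χ(m)`, `k = p^{min(M,t)}`). [folklore] -/
theorem exists_mem_zsmul_eq_map_of_zsmul_eq {X Y : Type*} [AddCommGroup X] [AddCommGroup Y]
    (Φ : X →+ Y) (A : AddSubgroup Y) (hΦA : ∀ x, Φ x ∈ A) {k : ℤ} {x Q : X} (hQ : k • Q = x) :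
    ∃ R ∈ A, k • R = Φ x :=
  ⟨Φ Q, hΦA Q, by rw [← map_zsmul, hQ]⟩

variable (W : WeierstrassCurve ℚ) (p : ℕ) (K : Type) [Field K] [NumberField K] (ιc : K →+* ℂ)

/-- **The ring-class-rational `E′`-datum with POINT DIVISIBILITY (D′)** — VERBATIM the body of the binder
`hR` of genus-p2's `GenusSharpKolyvagin.padicValNat_card_sha_add_le_of_ringClassRationalEprimePoints`
(item 23444, line `genus`, S4♯: sign `ε`, lift `τ` of complex conjugation, admissible modules `A m` rational
over embedded `K[m]`, points `P_m` with `P_1 = P`, `cP − εP` torsion, (E′) `n′·(A m)_v ⊆ E⁰` at `v ∋ p`,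
eigen relation, McCallum 4.4 switch) with its last clause (D) «`p^{M−t}·c_M(P_m) = 0`» REPLACED by
(D′) «`∃ R ∈ A m, p^{min M t} • R = P_m`» — the output currency of this line's `AbsorptionAtChi` on the
`E′`-side pushed through `Φ`.  [cite: GrossLMS1991, §4 (4.1), Prop. 3.7, (5.3)] [cite: McCallumLMS1991, §4–§5,
Prop. 4.4] [cite: Jetchev2008, Thm 1.4] -/
def GenusKolyvaginEprimePointsRDiv [W.IsElliptic] [Fact p.Prime] (Pt : (W.baseChange K).toAffine.Point)
    (t : ℕ) (n' : ℤ) : Prop :=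
  ∀ {M : ℕ} (_hM : 1 ≤ M)
    (hdiv : ∀ Q : geomPoints (W.baseChange K), ∃ R, ((p ^ M : ℕ) : ℤ) • R = Q)
    (c : K ≃ₐ[ℚ] K) (_hc : c ≠ 1),
    ∃ (ε : ℤ) (τ : AlgebraicClosure K ≃+* AlgebraicClosure K) (hτ : IsLiftOfAut c τ)
      (A : ℕ → AddSubgroup (geomPoints (W.baseChange K)))
      (hA : ∀ m, KolyvaginCocycle.IsAdmissible (Field.absoluteGaloisGroup K) (A m)
        ((p ^ M : ℕ) : ℤ))
      (emb : ∀ m : ℕ, ringClassField K ιc m →ₐ[K] AlgebraicClosure K)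
      (Pn : ℕ → geomPoints (W.baseChange K))
      (hPn : ∀ m, Pn m ∈
        KolyvaginCocycle.invPoints (Field.absoluteGaloisGroup K) (A m) ((p ^ M : ℕ) : ℤ)),
      (ε = 1 ∨ ε = -1) ∧
      IsOfFinAddOrder (Affine.Point.map (W' := W) (c : K →ₐ[ℚ] K) Pt - ε • Pt) ∧
      (∀ m, ∀ a ∈ A m, hτ.pointsMap W a ∈ A m) ∧
      Pn 1 = toGeomPoints (W.baseChange K) Pt ∧
      (∀ m, m ≠ 0 → ∀ a ∈ A m, ∀ Φ : Field.absoluteGaloisGroup K,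
        (∀ x : ringClassField K ιc m, Φ • emb m x = emb m x) → Φ • a = a) ∧
      (∀ m, ∀ a ∈ A m, ∀ v : HeightOneSpectrum (𝓞 K), ((p : ℕ) : 𝓞 K) ∈ v.asIdeal →
        n' • pointsMap (W.baseChange K) (v.adicCompletion K) a ∈ E0Receptacle (W.baseChange K) v) ∧
      (∀ m : ℕ, Squarefree m →
        (∀ q ∈ m.primeFactors,
          IsKolyvaginPrime (W.conductorNorm ℤ) W K p q ∧ FrobEqFrobInfty W K (p ^ M) q) →
        (∃ B ∈ A m, hτ.pointsMap W (Pn m) =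
          (ε * (-1) ^ m.primeFactors.card) • Pn m + ((p ^ M : ℕ) : ℤ) • B) ∧
        (∀ ℓ : ℕ, ℓ.Prime → ℓ ∣ m → ∀ v : HeightOneSpectrum (𝓞 K), (ℓ : 𝓞 K) ∈ v.asIdeal →
          ∀ a : ℕ, (((p : ℤ) ^ a) •
              kolyvaginClass (W.baseChange K) _ hdiv (hA m) (Pn m) (hPn m) ∈
              selmerLocalKer (W.baseChange K) (v.adicCompletion K) ((p ^ M : ℕ) : ℤ) ↔
            ((p : ℤ) ^ a) • kolyvaginClass (W.baseChange K) _ hdiv (hA (m / ℓ)) (Pn (m / ℓ))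
                (hPn (m / ℓ)) ∈
              (W.baseChange K).torsionLocalKer (v.adicCompletion K) ((p ^ M : ℕ) : ℤ))) ∧
        (∃ R ∈ A m, ((p ^ min M t : ℕ) : ℤ) • R = Pn m))

variable {W p K}

/-- **S4♭'s inequality from the (D′)-datum** — the (D)-TRANSPORT, PROVED: GIVEN the off-`p` Selmer clause
`hL` (VERBATIM genus-p2's, = the body of line `genus`'s `GenusKolyvaginLocalOffP W p K ιc`, PROVED on the
served frame in that skeleton) and a `GenusKolyvaginEprimePointsRDiv`-datum, THEN
`ord_p #Ш(W/K) + 2t ≤ 2·ord_p [W(K) : ℤP]`.  Proof: rebuild genus-p2's `hR` from the (D′)-datum, clause (D)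
by `pow_sub_zsmul_kolyvaginClass_eq_zero_of_pointDiv`, and apply
`GenusSharpKolyvagin.padicValNat_card_sha_add_le_of_ringClassRationalEprimePoints`.  Conditional on the
displayed binders; (D′) is NOT proved here.  [cite: GrossLMS1991, Prop. 4.7 (1), Prop. 6.2 (1)]
[cite: McCallumLMS1991, §5 Cor. 5.6] [cite: Jetchev2008, Thm. 1.4, Cor. 1.5] -/
theorem padicValNat_card_sha_add_le_of_genusKolyvaginEprimePointsRDiv [W.IsElliptic]
    (hK : IsImaginaryQuadratic K) {p : ℕ} [Fact p.Prime] (hp2 : p ≠ 2)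
    (hρ : W.HasSurjectiveModNGaloisRep p)
    {Pt : (W.baseChange K).toAffine.Point} (hnt : ¬ IsOfFinAddOrder Pt)
    (hidx : (AddSubgroup.zmultiples Pt).index ≠ 0) (t : ℕ) {n' : ℤ} (hn' : IsCoprime (p : ℤ) n')
    (hL : ∀ {m : ℕ} (_hm : m ≠ 0) (e : ringClassField K ιc m →ₐ[K] AlgebraicClosure K)
      (_hKol : ∀ q ∈ m.primeFactors, IsKolyvaginPrime (W.conductorNorm ℤ) W K p q)
      {M : ℕ} {hdiv : ∀ P : geomPoints (W.baseChange K), ∃ Q, ((p ^ M : ℕ) : ℤ) • Q = P}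
      {A : AddSubgroup (geomPoints (W.baseChange K))}
      (hA : KolyvaginCocycle.IsAdmissible (Field.absoluteGaloisGroup K) A ((p ^ M : ℕ) : ℤ))
      (_hArat : ∀ a ∈ A, ∀ Φ : Field.absoluteGaloisGroup K,
        (∀ x : ringClassField K ιc m, Φ • e x = e x) → Φ • a = a)
      {P : geomPoints (W.baseChange K)}
      (hP : P ∈ KolyvaginCocycle.invPoints (Field.absoluteGaloisGroup K) A ((p ^ M : ℕ) : ℤ))
      (v : HeightOneSpectrum (𝓞 K)) (_hv : ((m : ℕ) : 𝓞 K) ∉ v.asIdeal) (_hvp : ((p : ℕ) : 𝓞 K) ∉ v.asIdeal),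
      kolyvaginClass (W.baseChange K) ((p ^ M : ℕ) : ℤ) hdiv hA P hP ∈
        selmerLocalKer (W.baseChange K) (v.adicCompletion K) ((p ^ M : ℕ) : ℤ))
    (hR : GenusKolyvaginEprimePointsRDiv W p K ιc Pt t n')
    [Finite (W.baseChange K).sha] :
    padicValNat p (Nat.card (W.baseChange K).sha) + 2 * t ≤
      2 * padicValNat p (AddSubgroup.zmultiples Pt).index := by
  refine GenusSharpKolyvagin.padicValNat_card_sha_add_le_of_ringClassRationalEprimePoints W hK ιc hp2 hρ
    hnt hidx t hn' hL ?_
  intro M hM hdiv c hc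
  obtain ⟨ε, τ, hτ, A, hA, emb, Pn, hPn, hε, h53, hAτ, hPn1, hrat, hE0, hm⟩ := hR hM hdiv c hc
  exact ⟨ε, τ, hτ, A, hA, emb, Pn, hPn, hε, h53, hAτ, hPn1, hrat, hE0, fun m hsq hq ↦
    ⟨(hm m hsq hq).1, (hm m hsq hq).2.1,
      pow_sub_zsmul_kolyvaginClass_eq_zero_of_pointDiv (W.baseChange K) (hA m) (hPn m) (hm m hsq hq).2.2⟩⟩

end Transport

end Summit.BirchSwinnertonDyer.BirchSwinnertonDyer.Cruxes.EulerHalfNotRamNoInertSetAtFive.CarrierAbsorption
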